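import Summits.QuantumFields.YangMills.Theorems.UnitScaleTiltProp7ChartGaugeCurveAt
import Summits.QuantumFields.YangMills.Theorems.UnitScaleTiltProp7SymFrameBound
import Summits.QuantumFields.YangMills.Theorems.UnitScaleTiltProp7SymAvgTwSGaugeDir
import HarnessLib

/-!
# (q-gauge) SUPPLIER, S1-SPEC (2) — F3: **THE FRAME RESPONSE FR₁ AT A CHART POINT OF THE BALL, FROM THE ANALYTICITY OF THE SYMMETRIC FRAMES**, its value at the origin
# (`vd(0) = N∘x̂ − N⁽ᵏ⁾`), and the `s`-derivatives along a chart ray of the frames `v`, the response `vd` and the frame-corrected parameter `κ` — the letter (iv) of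
# ✓`Prop7ChartGaugeCovarianceDeriv.fderiv_logChartTwS_gaugeVelocity_apply` INHABITED on the ball, and the mixed chart×gauge derivative `κY` that (2) produces

Cell `ym3-torus` (HUMAN RULING D-0037, YM ladder rung R3 — SU(2) YM₃ on T³: NOT d = 4, NOT infinite volume, NOT a mass gap, NOT Clay).  Width seat `ym3-torus-px19` (gen 15); tower side of the
pointwise second-order gauge-covariance identity (2) (S1-SPEC (2), `h2` of ✓`Prop7AvgHessGaugeIdentityNormReading`).  THEOREMS ONLY (0 `def`, 0 `sorry`, default heartbeats);
`--supports stmt-QuantumFields-19200 --as helper`; count-neutral; NO claim on crux ∕ stub ∕ registry.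

THE MATHEMATICS.  Write `w_y(A) := frameTwS U₀ A y = v_{K−n}(U₀♭; e^{A}U₀♭)(ŷ)` for the accumulated symmetric frame ([Balaban1985Averaging] (97)) read in the chart.  At a printed-regular background
`w_y` is ANALYTIC on the frame-chart ball `‖A(b)‖ ≤ e·η` (✓`Prop7SymFrameBound.analyticAt_frameTwS_of_regPr`, windows `10¹²L³ε₀ ≤ 1`, `10⁹L²e ≤ 1`).  Along the gauge copies of `e^{A₀}U₀♭`
by `g_t = e^{tN}` the frames are `w_y(A_t)` with the chart curve `A_t` of F2 (✓`Prop7ChartGaugeCurveAt.expUnit_chartCurveAt_eventually_real`), so FR₁ AT THE CHART POINT `A₀` holds with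
`vd(A₀)(ŷ) := Dw_y(A₀)[V(A₀)]` (§2) — the letter (iv) of the first-order law is inhabited on the whole ball, not only at `A₀ = 0`; at `A₀ = 0` uniqueness of the derivative against FR₀ iterated
(✓`Prop7SymAvgTwSGaugeDir.hasDerivAt_frameAccU_of_avgSeq`) gives `Dw_y(0)[D_{U₀}N] = N(x̂ŷ) − ns_{K−n}(ŷ)` for every averaging sequence `ns` of `N` (§2).  Along the chart ray `A₀ = sY`
(complex `s`): `v(s) = w_y(sY)` has `v(0) = 1`, `v′(0) = Dw_y(0)[Y]`; `vd(s) = Dw_y(sY)[V(sY)]` has `vd′(0) = D²w_y(0)[Y, D_{U₀}N] + Dw_y(0)[½·comm]` (F2 ★★★`hasDerivAt_gaugeVelocityAt_smul`); and the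
frame-corrected parameter `κ(s) = v(s)⁻¹(N(x̂ŷ) − vd(s)v(s)⁻¹)v(s)` of ✓p769222 has `κ(0) = ns_{K−n}(ŷ)` and
**`κ′(0) = κY(ŷ) := (ns·v′ − v′·ns) + (N(x̂ŷ) − ns)·v′ − vd′`** (§3) — the chart×gauge mixed derivative of the coarse gauge map, the object «FR₂-lite» must weigh.

WHAT IS PROVED (namespace `…Theorems.Prop7FrameResponseAtChartPoint`; member `F`, `h : n ≤ K`, `RegPr F n K ε₀ U₀`, windows `10¹²L³ε₀ ≤ 1`, `10⁹L²e ≤ 1`, `0 < e`).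
* §1 `hasDerivAt_units_inv_complex` (complex-parameter twin of ✓`hasDerivAt_units_inv`), `lt_log_two_of_le_e_eta` (the frame-chart ball lies inside the `log` window; `η ≤ 1` is ✓`Prop7TwistedSliceGaugeOntoTower.eta_le_one`, inlined here to keep the imports light).
* §2 ★★`hasDerivAt_frameAccU_gaugeCopyAt` (FR₁ at `A₀`, real `t`, all top-level sites), ★`fderiv_frameTwS_zero_gaugeDir` (`Dw_y(0)[D_{U₀}N] = N(x̂ŷ) − ns(ŷ)`).
* §3 `frameTwS_smul_zero`, ★`hasDerivAt_frameTwS_smul`, ★`hasDerivAt_fderiv_frameTwS_smul_gaugeVelocity`, ★★★`hasDerivAt_kappaAt_smul` (`κ′(0) = κY(ŷ)`), `kappaAt_zero` (`κ(0) = ns(ŷ)`).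
HONEST SCOPE.  Chain-rule bookkeeping over landed analyticity; no estimate (FR₂-lite is NOT here); nothing of (2)'s assembly, `hqG`, norm_G, EX, the crux or rung R3 is proved here; the
Yang–Mills mass gap is NOT proved.

References: T. Bałaban, CMP **98** (1985) 17–51 [Balaban1985Averaging] ((11) p.19, (97) p.32, Prop. 4 p.38, (159)–(163) p.42); CMP **99** (1985) 389–434 [Balaban1985BackgroundPropagators]
((3.19) p.393, (3.114)–(3.115) p.418).
-/

set_option autoImplicit false

noncomputable section

open scoped Topology Matrix.Norms.L2Operator
open Filter NormedSpace

namespace Summit.QuantumFields.YangMills.Theorems.Prop7FrameResponseAtChartPoint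

open Literature.MathematicalPhysics.QuantumFieldTheory.Balaban1983to89
open Literature.MathematicalPhysics.QuantumFieldTheory.Balaban1983to89.T3ContinuumYM3Torus
open MatrixLog (mlog)
open B10Eq27TorusAxialLog (holT transl gaugeActT gaugeActT_apply)
open B7Prop1Explicit (expUnit val_expUnit disp)
open B7TransferAnalyticMean (meanCLM)
open T4Continuum BlockAveraging
open T3PrintedRegularMinimiser (RegPr)
open T3PrintedRegularOrbits (sites_eq)
open T3LevelShift (siteShift bondShift)
open T3SectALandauChart (bgUnits eta eta_pos)
open B15DeterminingSets (embIter)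
open Summit.QuantumFields.YangMills.Theorems.Prop8Chart (emlIterU)
open Summit.QuantumFields.YangMills.Theorems.Prop7SymAvgTwSym (frameAccU frameTwS frameTwS_def frameTwS_zero)
open Summit.QuantumFields.YangMills.Theorems.Prop7SymAvgGL (expUnit_zero_mul_bgUnits)
open Summit.QuantumFields.YangMills.Theorems.Prop7SymFrameBound (analyticAt_frameTwS_of_regPr)
open Summit.QuantumFields.YangMills.Theorems.Prop7SymAvgTwSGaugeDir (hasDerivAt_frameAccU_of_avgSeq)
open Summit.QuantumFields.YangMills.Theorems.Prop7ChartGaugeCurveAt (hasDerivAt_chartCurveAt_real chartCurveAt_zero expUnit_chartCurveAt_eventually_real gaugeVelocityAt_zero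
  hasDerivAt_gaugeVelocityAt_smul gaugeFamily_zero hasDerivAt_gaugeFamily)

/-! ## §1 Letters -/

section Letters

variable {𝔸 : Type*} [NormedRing 𝔸] [NormedAlgebra ℂ 𝔸] [CompleteSpace 𝔸]

/-- **Derivative of the inverse of a unit-valued curve** (complex parameter): `d∕ds (h s)⁻¹ = −(h s₀)⁻¹·h′·(h s₀)⁻¹`. [folklore] -/
theorem hasDerivAt_units_inv_complex {γ : ℂ → 𝔸ˣ} {M : 𝔸} {s₀ : ℂ} (hd : HasDerivAt (fun s : ℂ => ((γ s : 𝔸ˣ) : 𝔸)) M s₀) :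
    HasDerivAt (fun s : ℂ => (((γ s)⁻¹ : 𝔸ˣ) : 𝔸)) (-((((γ s₀)⁻¹ : 𝔸ˣ) : 𝔸) * M * (((γ s₀)⁻¹ : 𝔸ˣ) : 𝔸))) s₀ := by
  have hinv_eq : (fun s : ℂ => (((γ s)⁻¹ : 𝔸ˣ) : 𝔸)) = fun s => Ring.inverse ((γ s : 𝔸ˣ) : 𝔸) := by
    funext s; exact (Ring.inverse_unit _).symm
  have h1 : HasFDerivAt (Ring.inverse : 𝔸 → 𝔸) (-ContinuousLinearMap.mulLeftRight ℂ 𝔸 (((γ s₀)⁻¹ : 𝔸ˣ) : 𝔸) (((γ s₀)⁻¹ : 𝔸ˣ) : 𝔸)) ((γ s₀ : 𝔸ˣ) : 𝔸) :=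
    hasFDerivAt_ringInverse (γ s₀)
  have h2 := h1.comp_hasDerivAt s₀ hd
  rw [hinv_eq]
  refine h2.congr_deriv ?_
  simp

end Letters

section Windows

variable {F : T3Family} {n K : ℕ}

/-- **THE FRAME-CHART BALL LIES INSIDE THE `log` WINDOW**: `10⁹L²e ≤ 1` and `‖A₀(b)‖ ≤ e·η` ⟹ `‖A₀(b)‖ < log 2`. [folklore] -/
theorem lt_log_two_of_le_e_eta {e : ℝ} (hWe : 10 ^ 9 * (F.L : ℝ) ^ 2 * e ≤ 1) {A₀ : PBond (F.P K) 0 → Matrix (Fin 2) (Fin 2) ℂ}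
    (hA₀ : ∀ b, ‖A₀ b‖ ≤ e * eta F n K) (b : PBond (F.P K) 0) : ‖A₀ b‖ < Real.log 2 := by
  have hL1 : (1 : ℝ) ≤ F.L := by exact_mod_cast F.hL.2.le
  have hL2 : (1 : ℝ) ≤ (F.L : ℝ) ^ 2 := one_le_pow₀ hL1
  have he : e ≤ 10⁻¹ := by nlinarith
  have hη : eta F n K ≤ 1 := by
    unfold eta
    exact pow_le_one₀ (inv_nonneg.2 (by linarith)) (inv_le_one_of_one_le₀ hL1)
  have hη0 := (eta_pos F n K).le
  have h1 : e * eta F n K ≤ 10⁻¹ := by nlinarith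
  have h2 : (10⁻¹ : ℝ) < Real.log 2 := by have := Real.log_two_gt_d9; linarith
  linarith [hA₀ b]

end Windows

/-! ## §2 FR₁ at a chart point of the ball, and its value at the origin -/

section Member

variable (F : T3Family) {n K : ℕ} (h : n ≤ K)

/-- ★★ **FR₁ AT A CHART POINT OF THE BALL** — the letter (iv) `hFr` of ✓`fderiv_logChartTwS_gaugeVelocity_apply` INHABITED at every `A₀` with `‖A₀(b)‖ ≤ e·η`: along the gauge copies
`(e^{A₀}U₀♭)^{g_t}`, `g_t = e^{tN}` (real `t`), the top-level accumulated frame at `x̂ = siteShift y` has derivative `Dw_y(A₀)[V(A₀)]` at `t = 0` (`w_y = frameTwS U₀ · y` analytic at `A₀`;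
the copies are `e^{A_t}U₀♭` for small `t`, F2). [cite: Balaban1985Averaging, (11) p.19, (97) p.32, Prop. 4 p.38] -/
theorem hasDerivAt_frameAccU_gaugeCopyAt {ε₀ e : ℝ} (hε₀ : 0 < ε₀) (he : 0 < e) (hWe : 10 ^ 9 * (F.L : ℝ) ^ 2 * e ≤ 1) (hWε : 10 ^ 12 * (F.L : ℝ) ^ 3 * ε₀ ≤ 1)
    (U₀ : GaugeField (F.P K) 0 (Matrix.specialUnitaryGroup (Fin 2) ℂ)) (hreg : RegPr F n K ε₀ U₀) (N : Site (F.P K) 0 → Matrix (Fin 2) (Fin 2) ℂ)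
    {A₀ : PBond (F.P K) 0 → Matrix (Fin 2) (Fin 2) ℂ} (hA₀ : ∀ b, ‖A₀ b‖ ≤ e * eta F n K) (y : Site (F.P n) 0) :
    HasDerivAt (fun t : ℝ => ((frameAccU (K - n) (bgUnits F K U₀) (gaugeActT (fun x : Site (F.P K) 0 => expUnit ((t : ℂ) • N x)) (fun b => expUnit (A₀ b) * bgUnits F K U₀ b))
        (siteShift (sites_eq F n K h) y) : (Matrix (Fin 2) (Fin 2) ℂ)ˣ) : Matrix (Fin 2) (Fin 2) ℂ))
      (fderiv ℂ (fun A : PBond (F.P K) 0 → Matrix (Fin 2) (Fin 2) ℂ => ((frameTwS F n K h U₀ A y : (Matrix (Fin 2) (Fin 2) ℂ)ˣ) : Matrix (Fin 2) (Fin 2) ℂ)) A₀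
        (fun b : PBond (F.P K) 0 => fderiv ℂ (mlog : Matrix (Fin 2) (Fin 2) ℂ → Matrix (Fin 2) (Fin 2) ℂ) (exp (A₀ b))
          (N b.src * exp (A₀ b) - exp (A₀ b) * (((bgUnits F K U₀ b : (Matrix (Fin 2) (Fin 2) ℂ)ˣ) : Matrix (Fin 2) (Fin 2) ℂ) * N b.tgt
            * (((bgUnits F K U₀ b)⁻¹ : (Matrix (Fin 2) (Fin 2) ℂ)ˣ) : Matrix (Fin 2) (Fin 2) ℂ))))) 0 := by
  have hlog : ∀ b, ‖A₀ b‖ < Real.log 2 := lt_log_two_of_le_e_eta hWe hA₀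
  have han := (analyticAt_frameTwS_of_regPr F h hε₀ he.le hWε hWe U₀ hreg y hA₀).1
  have hD : HasFDerivAt (fun A : PBond (F.P K) 0 → Matrix (Fin 2) (Fin 2) ℂ => ((frameTwS F n K h U₀ A y : (Matrix (Fin 2) (Fin 2) ℂ)ˣ) : Matrix (Fin 2) (Fin 2) ℂ))
      (fderiv ℂ (fun A : PBond (F.P K) 0 → Matrix (Fin 2) (Fin 2) ℂ => ((frameTwS F n K h U₀ A y : (Matrix (Fin 2) (Fin 2) ℂ)ˣ) : Matrix (Fin 2) (Fin 2) ℂ)) A₀) A₀ :=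
    han.differentiableAt.hasFDerivAt
  have hA0 : A₀ = (fun t : ℝ => fun b : PBond (F.P K) 0 =>
        mlog (exp ((t : ℂ) • N b.src) * (exp (A₀ b) * ((bgUnits F K U₀ b : (Matrix (Fin 2) (Fin 2) ℂ)ˣ) : Matrix (Fin 2) (Fin 2) ℂ)) * exp ((t : ℂ) • (-N b.tgt))
          * (((bgUnits F K U₀ b)⁻¹ : (Matrix (Fin 2) (Fin 2) ℂ)ˣ) : Matrix (Fin 2) (Fin 2) ℂ))) 0 := by
    simp only [Complex.ofReal_zero]
    exact (chartCurveAt_zero U₀ N hlog).symm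
  have hcomp := (hD.restrictScalars ℝ).comp_hasDerivAt_of_eq (0 : ℝ) (hasDerivAt_chartCurveAt_real U₀ N hlog) hA0
  have hev : (fun t : ℝ => ((frameAccU (K - n) (bgUnits F K U₀) (gaugeActT (fun x : Site (F.P K) 0 => expUnit ((t : ℂ) • N x)) (fun b => expUnit (A₀ b) * bgUnits F K U₀ b))
        (siteShift (sites_eq F n K h) y) : (Matrix (Fin 2) (Fin 2) ℂ)ˣ) : Matrix (Fin 2) (Fin 2) ℂ))
      =ᶠ[𝓝 0] ((fun A : PBond (F.P K) 0 → Matrix (Fin 2) (Fin 2) ℂ => ((frameTwS F n K h U₀ A y : (Matrix (Fin 2) (Fin 2) ℂ)ˣ) : Matrix (Fin 2) (Fin 2) ℂ)) ∘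
        (fun t : ℝ => fun b : PBond (F.P K) 0 =>
          mlog (exp ((t : ℂ) • N b.src) * (exp (A₀ b) * ((bgUnits F K U₀ b : (Matrix (Fin 2) (Fin 2) ℂ)ˣ) : Matrix (Fin 2) (Fin 2) ℂ)) * exp ((t : ℂ) • (-N b.tgt))
            * (((bgUnits F K U₀ b)⁻¹ : (Matrix (Fin 2) (Fin 2) ℂ)ˣ) : Matrix (Fin 2) (Fin 2) ℂ)))) := by
    filter_upwards [expUnit_chartCurveAt_eventually_real U₀ N hlog] with t ht
    rw [Function.comp_apply, frameTwS_def, ht]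
  have h2 := hcomp.congr_of_eventuallyEq hev
  simpa only [ContinuousLinearMap.coe_restrictScalars'] using h2

/-- ★ **THE FRAME RESPONSE AT THE ORIGIN, IN THE CHART**: for every averaging sequence `ns` of `N` against the background tower (`ns 0 = N`, `ns (j+1) = ` block Ad-average of `ns j`),
`Dw_y(0)[D_{U₀}N] = N(x̂ŷ) − ns_{K−n}(ŷ)` — §2's FR₁ at `A₀ = 0` against FR₀ iterated (✓`hasDerivAt_frameAccU_of_avgSeq`) by uniqueness of the derivative.
[cite: Balaban1985Averaging, (97) p.32; Balaban1985BackgroundPropagators, (3.19) p.393] -/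
theorem fderiv_frameTwS_zero_gaugeDir {ε₀ : ℝ} (hε₀ : 0 < ε₀) (hWε : 10 ^ 12 * (F.L : ℝ) ^ 3 * ε₀ ≤ 1)
    (U₀ : GaugeField (F.P K) 0 (Matrix.specialUnitaryGroup (Fin 2) ℂ)) (hreg : RegPr F n K ε₀ U₀) (N : Site (F.P K) 0 → Matrix (Fin 2) (Fin 2) ℂ)
    (ns : (j : ℕ) → Site (F.P K) j → Matrix (Fin 2) (Fin 2) ℂ) (h0 : ns 0 = N)
    (hsucc : ∀ (j : ℕ) (z : Site (F.P K) (j + 1)), ns (j + 1) z = ns j (emb z) - meanCLM (Idx (F.P K)) (Matrix (Fin 2) (Fin 2) ℂ) fun i : Idx (F.P K) =>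
        ns j (emb z) - ((holT (emlIterU j (bgUnits F K U₀)) (emb z) (stairWord i.2.1 (off i.1)) : (Matrix (Fin 2) (Fin 2) ℂ)ˣ) : Matrix (Fin 2) (Fin 2) ℂ) *
          ns j (transl (emb z) (disp (stairWord i.2.1 (off i.1)))) * (((holT (emlIterU j (bgUnits F K U₀)) (emb z) (stairWord i.2.1 (off i.1)))⁻¹ : (Matrix (Fin 2) (Fin 2) ℂ)ˣ) : Matrix (Fin 2) (Fin 2) ℂ))
    (y : Site (F.P n) 0) :
    fderiv ℂ (fun A : PBond (F.P K) 0 → Matrix (Fin 2) (Fin 2) ℂ => ((frameTwS F n K h U₀ A y : (Matrix (Fin 2) (Fin 2) ℂ)ˣ) : Matrix (Fin 2) (Fin 2) ℂ)) 0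
        (fun b : PBond (F.P K) 0 => N b.src - ((bgUnits F K U₀ b : (Matrix (Fin 2) (Fin 2) ℂ)ˣ) : Matrix (Fin 2) (Fin 2) ℂ) * N b.tgt * (((bgUnits F K U₀ b)⁻¹ : (Matrix (Fin 2) (Fin 2) ℂ)ˣ) : Matrix (Fin 2) (Fin 2) ℂ))
      = N (embIter (K - n) (siteShift (sites_eq F n K h) y)) - ns (K - n) (siteShift (sites_eq F n K h) y) := by
  -- the L-only chart radius `e = (10⁹L²)⁻¹`
  have hL0 : (0 : ℝ) < F.L := by exact_mod_cast (lt_trans zero_lt_one F.hL.2)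
  set e : ℝ := (10 ^ 9 * (F.L : ℝ) ^ 2)⁻¹ with he
  have hpos : (0 : ℝ) < 10 ^ 9 * (F.L : ℝ) ^ 2 := by positivity
  have he0 : 0 < e := by rw [he]; exact inv_pos.2 hpos
  have hWe : 10 ^ 9 * (F.L : ℝ) ^ 2 * e ≤ 1 := by rw [he, mul_inv_cancel₀ hpos.ne']
  have hA₀ : ∀ b : PBond (F.P K) 0, ‖(0 : PBond (F.P K) 0 → Matrix (Fin 2) (Fin 2) ℂ) b‖ ≤ e * eta F n K := fun b => by
    rw [Pi.zero_apply, norm_zero]; exact (mul_pos he0 (eta_pos F n K)).le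
  -- FR₁ at `A₀ = 0` (§2) ...
  have h1 := hasDerivAt_frameAccU_gaugeCopyAt F h hε₀ he0 hWe hWε U₀ hreg N hA₀ y
  rw [gaugeVelocityAt_zero U₀ N, expUnit_zero_mul_bgUnits] at h1
  -- ... against FR₀ iterated along the averaging sequence
  have h2 := hasDerivAt_frameAccU_of_avgSeq (bgUnits F K U₀) (g := fun (t : ℝ) (x : Site (F.P K) 0) => expUnit ((t : ℂ) • N x)) (gaugeFamily_zero N) (hasDerivAt_gaugeFamily N)
    ns h0 hsucc (K - n) (siteShift (sites_eq F n K h) y)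
  exact h1.unique h2

/-! ## §3 Along the chart ray `A₀ = sY`: the frames, the response and the frame-corrected parameter -/

/-- `w_y(0·Y) = 1`. [cite: Balaban1985Averaging, (97) p.32] -/
theorem frameTwS_smul_zero (U₀ : GaugeField (F.P K) 0 (Matrix.specialUnitaryGroup (Fin 2) ℂ)) (Y : PBond (F.P K) 0 → Matrix (Fin 2) (Fin 2) ℂ) (y : Site (F.P n) 0) :
    frameTwS F n K h U₀ ((0 : ℂ) • Y) y = 1 := by
  rw [zero_smul, frameTwS_zero]

/-- ★ **THE FRAMES ALONG THE CHART RAY**: `s ↦ w_y(sY)` has derivative `Dw_y(0)[Y]` at `s = 0` (analyticity at the origin). [cite: Balaban1985Averaging, (97) p.32, Prop. 4 p.38] -/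
theorem hasDerivAt_frameTwS_smul {ε₀ : ℝ} (hε₀ : 0 < ε₀) (hWε : 10 ^ 12 * (F.L : ℝ) ^ 3 * ε₀ ≤ 1)
    (U₀ : GaugeField (F.P K) 0 (Matrix.specialUnitaryGroup (Fin 2) ℂ)) (hreg : RegPr F n K ε₀ U₀) (Y : PBond (F.P K) 0 → Matrix (Fin 2) (Fin 2) ℂ) (y : Site (F.P n) 0) :
    HasDerivAt (fun s : ℂ => ((frameTwS F n K h U₀ (s • Y) y : (Matrix (Fin 2) (Fin 2) ℂ)ˣ) : Matrix (Fin 2) (Fin 2) ℂ))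
      (fderiv ℂ (fun A : PBond (F.P K) 0 → Matrix (Fin 2) (Fin 2) ℂ => ((frameTwS F n K h U₀ A y : (Matrix (Fin 2) (Fin 2) ℂ)ˣ) : Matrix (Fin 2) (Fin 2) ℂ)) 0 Y) 0 := by
  have hL0 : (0 : ℝ) < F.L := by exact_mod_cast (lt_trans zero_lt_one F.hL.2)
  set e : ℝ := (10 ^ 9 * (F.L : ℝ) ^ 2)⁻¹ with he
  have hpos : (0 : ℝ) < 10 ^ 9 * (F.L : ℝ) ^ 2 := by positivity
  have he0 : 0 < e := by rw [he]; exact inv_pos.2 hpos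
  have hWe : 10 ^ 9 * (F.L : ℝ) ^ 2 * e ≤ 1 := by rw [he, mul_inv_cancel₀ hpos.ne']
  have hA₀ : ∀ b : PBond (F.P K) 0, ‖(0 : PBond (F.P K) 0 → Matrix (Fin 2) (Fin 2) ℂ) b‖ ≤ e * eta F n K := fun b => by
    rw [Pi.zero_apply, norm_zero]; exact (mul_pos he0 (eta_pos F n K)).le
  have han := (analyticAt_frameTwS_of_regPr F h hε₀ he0.le hWε hWe U₀ hreg y hA₀).1
  have hD : HasFDerivAt (fun A : PBond (F.P K) 0 → Matrix (Fin 2) (Fin 2) ℂ => ((frameTwS F n K h U₀ A y : (Matrix (Fin 2) (Fin 2) ℂ)ˣ) : Matrix (Fin 2) (Fin 2) ℂ))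
      (fderiv ℂ (fun A : PBond (F.P K) 0 → Matrix (Fin 2) (Fin 2) ℂ => ((frameTwS F n K h U₀ A y : (Matrix (Fin 2) (Fin 2) ℂ)ˣ) : Matrix (Fin 2) (Fin 2) ℂ)) 0) ((0 : ℂ) • Y) := by
    rw [zero_smul]; exact han.differentiableAt.hasFDerivAt
  have hs : HasDerivAt (fun s : ℂ => s • Y) Y 0 := by simpa using (hasDerivAt_id (0 : ℂ)).smul_const Y
  have h := hD.comp_hasDerivAt (0 : ℂ) hs
  simpa only [Function.comp_def] using h

/-- ★ **THE RESPONSE ALONG THE CHART RAY**: `s ↦ vd(sY) = Dw_y(sY)[V(sY)]` has derivative `D²w_y(0)[Y, D_{U₀}N] + Dw_y(0)[½·comm]` at `s = 0` (`HasDerivAt.clm_apply`: `Dw_y` is differentiable at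
`0` by analyticity, `V` by F2 ★★★`hasDerivAt_gaugeVelocityAt_smul`). [cite: Balaban1985Averaging, (97) p.32, Prop. 4 p.38; Balaban1985BackgroundPropagators, (3.114)–(3.115) p.418] -/
theorem hasDerivAt_fderiv_frameTwS_smul_gaugeVelocity {ε₀ : ℝ} (hε₀ : 0 < ε₀) (hWε : 10 ^ 12 * (F.L : ℝ) ^ 3 * ε₀ ≤ 1)
    (U₀ : GaugeField (F.P K) 0 (Matrix.specialUnitaryGroup (Fin 2) ℂ)) (hreg : RegPr F n K ε₀ U₀) (Y : PBond (F.P K) 0 → Matrix (Fin 2) (Fin 2) ℂ)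
    (N : Site (F.P K) 0 → Matrix (Fin 2) (Fin 2) ℂ) (y : Site (F.P n) 0) :
    HasDerivAt (fun s : ℂ => fderiv ℂ (fun A : PBond (F.P K) 0 → Matrix (Fin 2) (Fin 2) ℂ => ((frameTwS F n K h U₀ A y : (Matrix (Fin 2) (Fin 2) ℂ)ˣ) : Matrix (Fin 2) (Fin 2) ℂ)) (s • Y)
        (fun b : PBond (F.P K) 0 => fderiv ℂ (mlog : Matrix (Fin 2) (Fin 2) ℂ → Matrix (Fin 2) (Fin 2) ℂ) (exp ((s • Y) b))
          (N b.src * exp ((s • Y) b) - exp ((s • Y) b)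
            * (((bgUnits F K U₀ b : (Matrix (Fin 2) (Fin 2) ℂ)ˣ) : Matrix (Fin 2) (Fin 2) ℂ) * N b.tgt * (((bgUnits F K U₀ b)⁻¹ : (Matrix (Fin 2) (Fin 2) ℂ)ˣ) : Matrix (Fin 2) (Fin 2) ℂ)))))
      (fderiv ℂ (fderiv ℂ (fun A : PBond (F.P K) 0 → Matrix (Fin 2) (Fin 2) ℂ => ((frameTwS F n K h U₀ A y : (Matrix (Fin 2) (Fin 2) ℂ)ˣ) : Matrix (Fin 2) (Fin 2) ℂ))) 0 Y
          (fun b : PBond (F.P K) 0 => N b.src - ((bgUnits F K U₀ b : (Matrix (Fin 2) (Fin 2) ℂ)ˣ) : Matrix (Fin 2) (Fin 2) ℂ) * N b.tgt * (((bgUnits F K U₀ b)⁻¹ : (Matrix (Fin 2) (Fin 2) ℂ)ˣ) : Matrix (Fin 2) (Fin 2) ℂ))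
        + fderiv ℂ (fun A : PBond (F.P K) 0 → Matrix (Fin 2) (Fin 2) ℂ => ((frameTwS F n K h U₀ A y : (Matrix (Fin 2) (Fin 2) ℂ)ˣ) : Matrix (Fin 2) (Fin 2) ℂ)) 0
          (fun b : PBond (F.P K) 0 => (2 : ℂ)⁻¹ •
            ((N b.src + ((bgUnits F K U₀ b : (Matrix (Fin 2) (Fin 2) ℂ)ˣ) : Matrix (Fin 2) (Fin 2) ℂ) * N b.tgt * (((bgUnits F K U₀ b)⁻¹ : (Matrix (Fin 2) (Fin 2) ℂ)ˣ) : Matrix (Fin 2) (Fin 2) ℂ)) * Y b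
              - Y b * (N b.src + ((bgUnits F K U₀ b : (Matrix (Fin 2) (Fin 2) ℂ)ˣ) : Matrix (Fin 2) (Fin 2) ℂ) * N b.tgt * (((bgUnits F K U₀ b)⁻¹ : (Matrix (Fin 2) (Fin 2) ℂ)ˣ) : Matrix (Fin 2) (Fin 2) ℂ))))) 0 := by
  have hL0 : (0 : ℝ) < F.L := by exact_mod_cast (lt_trans zero_lt_one F.hL.2)
  set e : ℝ := (10 ^ 9 * (F.L : ℝ) ^ 2)⁻¹ with he
  have hpos : (0 : ℝ) < 10 ^ 9 * (F.L : ℝ) ^ 2 := by positivity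
  have he0 : 0 < e := by rw [he]; exact inv_pos.2 hpos
  have hWe : 10 ^ 9 * (F.L : ℝ) ^ 2 * e ≤ 1 := by rw [he, mul_inv_cancel₀ hpos.ne']
  have hA₀ : ∀ b : PBond (F.P K) 0, ‖(0 : PBond (F.P K) 0 → Matrix (Fin 2) (Fin 2) ℂ) b‖ ≤ e * eta F n K := fun b => by
    rw [Pi.zero_apply, norm_zero]; exact (mul_pos he0 (eta_pos F n K)).le
  have han := (analyticAt_frameTwS_of_regPr F h hε₀ he0.le hWε hWe U₀ hreg y hA₀).1
  have hD2 : HasFDerivAt (fderiv ℂ (fun A : PBond (F.P K) 0 → Matrix (Fin 2) (Fin 2) ℂ => ((frameTwS F n K h U₀ A y : (Matrix (Fin 2) (Fin 2) ℂ)ˣ) : Matrix (Fin 2) (Fin 2) ℂ)))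
      (fderiv ℂ (fderiv ℂ (fun A : PBond (F.P K) 0 → Matrix (Fin 2) (Fin 2) ℂ => ((frameTwS F n K h U₀ A y : (Matrix (Fin 2) (Fin 2) ℂ)ˣ) : Matrix (Fin 2) (Fin 2) ℂ))) 0) 0 :=
    han.fderiv.differentiableAt.hasFDerivAt
  have hs : HasDerivAt (fun s : ℂ => s • Y) Y 0 := by simpa using (hasDerivAt_id (0 : ℂ)).smul_const Y
  have hs0 : (0 : PBond (F.P K) 0 → Matrix (Fin 2) (Fin 2) ℂ) = (fun s : ℂ => s • Y) 0 := by simp only [zero_smul]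
  have hc : HasDerivAt (fun s : ℂ => fderiv ℂ (fun A : PBond (F.P K) 0 → Matrix (Fin 2) (Fin 2) ℂ => ((frameTwS F n K h U₀ A y : (Matrix (Fin 2) (Fin 2) ℂ)ˣ) : Matrix (Fin 2) (Fin 2) ℂ)) (s • Y))
      (fderiv ℂ (fderiv ℂ (fun A : PBond (F.P K) 0 → Matrix (Fin 2) (Fin 2) ℂ => ((frameTwS F n K h U₀ A y : (Matrix (Fin 2) (Fin 2) ℂ)ˣ) : Matrix (Fin 2) (Fin 2) ℂ))) 0 Y) 0 := by
    have h1 := HasFDerivAt.comp_hasDerivAt_of_eq (𝕜 := ℂ)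
      (l := fderiv ℂ (fun A : PBond (F.P K) 0 → Matrix (Fin 2) (Fin 2) ℂ => ((frameTwS F n K h U₀ A y : (Matrix (Fin 2) (Fin 2) ℂ)ˣ) : Matrix (Fin 2) (Fin 2) ℂ)))
      (l' := fderiv ℂ (fderiv ℂ (fun A : PBond (F.P K) 0 → Matrix (Fin 2) (Fin 2) ℂ => ((frameTwS F n K h U₀ A y : (Matrix (Fin 2) (Fin 2) ℂ)ˣ) : Matrix (Fin 2) (Fin 2) ℂ))) 0)
      (0 : ℂ) hD2 hs hs0
    simpa only [Function.comp_def] using h1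
  have h2 := hc.clm_apply (hasDerivAt_gaugeVelocityAt_smul U₀ N Y)
  rw [zero_smul, gaugeVelocityAt_zero U₀ N] at h2
  exact h2

/-- **`κ(0) = ns(ŷ)`**: at the origin the frame-corrected parameter of ✓p769222 is the averaged one (`v(0) = 1`, §2). [cite: Balaban1985BackgroundPropagators, (3.19) p.393] -/
theorem kappaAt_zero {ε₀ : ℝ} (hε₀ : 0 < ε₀) (hWε : 10 ^ 12 * (F.L : ℝ) ^ 3 * ε₀ ≤ 1)
    (U₀ : GaugeField (F.P K) 0 (Matrix.specialUnitaryGroup (Fin 2) ℂ)) (hreg : RegPr F n K ε₀ U₀) (Y : PBond (F.P K) 0 → Matrix (Fin 2) (Fin 2) ℂ) (N : Site (F.P K) 0 → Matrix (Fin 2) (Fin 2) ℂ)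
    (ns : (j : ℕ) → Site (F.P K) j → Matrix (Fin 2) (Fin 2) ℂ) (h0 : ns 0 = N)
    (hsucc : ∀ (j : ℕ) (z : Site (F.P K) (j + 1)), ns (j + 1) z = ns j (emb z) - meanCLM (Idx (F.P K)) (Matrix (Fin 2) (Fin 2) ℂ) fun i : Idx (F.P K) =>
        ns j (emb z) - ((holT (emlIterU j (bgUnits F K U₀)) (emb z) (stairWord i.2.1 (off i.1)) : (Matrix (Fin 2) (Fin 2) ℂ)ˣ) : Matrix (Fin 2) (Fin 2) ℂ) *
          ns j (transl (emb z) (disp (stairWord i.2.1 (off i.1)))) * (((holT (emlIterU j (bgUnits F K U₀)) (emb z) (stairWord i.2.1 (off i.1)))⁻¹ : (Matrix (Fin 2) (Fin 2) ℂ)ˣ) : Matrix (Fin 2) (Fin 2) ℂ))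
    (y : Site (F.P n) 0) :
    (((frameTwS F n K h U₀ ((0 : ℂ) • Y) y)⁻¹ : (Matrix (Fin 2) (Fin 2) ℂ)ˣ) : Matrix (Fin 2) (Fin 2) ℂ)
        * (N (embIter (K - n) (siteShift (sites_eq F n K h) y))
            - fderiv ℂ (fun A : PBond (F.P K) 0 → Matrix (Fin 2) (Fin 2) ℂ => ((frameTwS F n K h U₀ A y : (Matrix (Fin 2) (Fin 2) ℂ)ˣ) : Matrix (Fin 2) (Fin 2) ℂ)) ((0 : ℂ) • Y)
                (fun b : PBond (F.P K) 0 => fderiv ℂ (mlog : Matrix (Fin 2) (Fin 2) ℂ → Matrix (Fin 2) (Fin 2) ℂ) (exp (((0 : ℂ) • Y) b))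
                  (N b.src * exp (((0 : ℂ) • Y) b) - exp (((0 : ℂ) • Y) b)
                    * (((bgUnits F K U₀ b : (Matrix (Fin 2) (Fin 2) ℂ)ˣ) : Matrix (Fin 2) (Fin 2) ℂ) * N b.tgt * (((bgUnits F K U₀ b)⁻¹ : (Matrix (Fin 2) (Fin 2) ℂ)ˣ) : Matrix (Fin 2) (Fin 2) ℂ))))
              * (((frameTwS F n K h U₀ ((0 : ℂ) • Y) y)⁻¹ : (Matrix (Fin 2) (Fin 2) ℂ)ˣ) : Matrix (Fin 2) (Fin 2) ℂ))
        * ((frameTwS F n K h U₀ ((0 : ℂ) • Y) y : (Matrix (Fin 2) (Fin 2) ℂ)ˣ) : Matrix (Fin 2) (Fin 2) ℂ)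
      = ns (K - n) (siteShift (sites_eq F n K h) y) := by
  rw [zero_smul, frameTwS_zero, inv_one, Units.val_one, one_mul, mul_one, mul_one, gaugeVelocityAt_zero U₀ N, fderiv_frameTwS_zero_gaugeDir F h hε₀ hWε U₀ hreg N ns h0 hsucc y]
  abel

/-- ★★★ **THE CHART×GAUGE MIXED DERIVATIVE `κY`**: along the chart ray, the frame-corrected coarse parameter `κ(s) = v(s)⁻¹(N(x̂ŷ) − vd(s)v(s)⁻¹)v(s)` of ✓p769222 (`v(s) = w_y(sY)`,
`vd(s) = Dw_y(sY)[V(sY)]`) is differentiable at `s = 0` with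
`κ′(0) = κY(ŷ) := (ns(ŷ)·v′ − v′·ns(ŷ)) + (N(x̂ŷ) − ns(ŷ))·v′ − vd′`, `v′ = Dw_y(0)[Y]`, `vd′ = D²w_y(0)[Y, D_{U₀}N] + Dw_y(0)[½·comm]` — the object (2) produces and FR₂-lite must weigh.
[cite: Balaban1985Averaging, (97) p.32; Balaban1985BackgroundPropagators, (3.19) p.393, (3.114)–(3.115) p.418] -/
theorem hasDerivAt_kappaAt_smul {ε₀ : ℝ} (hε₀ : 0 < ε₀) (hWε : 10 ^ 12 * (F.L : ℝ) ^ 3 * ε₀ ≤ 1)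
    (U₀ : GaugeField (F.P K) 0 (Matrix.specialUnitaryGroup (Fin 2) ℂ)) (hreg : RegPr F n K ε₀ U₀) (Y : PBond (F.P K) 0 → Matrix (Fin 2) (Fin 2) ℂ) (N : Site (F.P K) 0 → Matrix (Fin 2) (Fin 2) ℂ)
    (ns : (j : ℕ) → Site (F.P K) j → Matrix (Fin 2) (Fin 2) ℂ) (h0 : ns 0 = N)
    (hsucc : ∀ (j : ℕ) (z : Site (F.P K) (j + 1)), ns (j + 1) z = ns j (emb z) - meanCLM (Idx (F.P K)) (Matrix (Fin 2) (Fin 2) ℂ) fun i : Idx (F.P K) =>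
        ns j (emb z) - ((holT (emlIterU j (bgUnits F K U₀)) (emb z) (stairWord i.2.1 (off i.1)) : (Matrix (Fin 2) (Fin 2) ℂ)ˣ) : Matrix (Fin 2) (Fin 2) ℂ) *
          ns j (transl (emb z) (disp (stairWord i.2.1 (off i.1)))) * (((holT (emlIterU j (bgUnits F K U₀)) (emb z) (stairWord i.2.1 (off i.1)))⁻¹ : (Matrix (Fin 2) (Fin 2) ℂ)ˣ) : Matrix (Fin 2) (Fin 2) ℂ))
    (y : Site (F.P n) 0) :
    HasDerivAt (fun s : ℂ =>
      (((frameTwS F n K h U₀ (s • Y) y)⁻¹ : (Matrix (Fin 2) (Fin 2) ℂ)ˣ) : Matrix (Fin 2) (Fin 2) ℂ)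
        * (N (embIter (K - n) (siteShift (sites_eq F n K h) y))
            - fderiv ℂ (fun A : PBond (F.P K) 0 → Matrix (Fin 2) (Fin 2) ℂ => ((frameTwS F n K h U₀ A y : (Matrix (Fin 2) (Fin 2) ℂ)ˣ) : Matrix (Fin 2) (Fin 2) ℂ)) (s • Y)
                (fun b : PBond (F.P K) 0 => fderiv ℂ (mlog : Matrix (Fin 2) (Fin 2) ℂ → Matrix (Fin 2) (Fin 2) ℂ) (exp ((s • Y) b))
                  (N b.src * exp ((s • Y) b) - exp ((s • Y) b)
                    * (((bgUnits F K U₀ b : (Matrix (Fin 2) (Fin 2) ℂ)ˣ) : Matrix (Fin 2) (Fin 2) ℂ) * N b.tgt * (((bgUnits F K U₀ b)⁻¹ : (Matrix (Fin 2) (Fin 2) ℂ)ˣ) : Matrix (Fin 2) (Fin 2) ℂ))))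
              * (((frameTwS F n K h U₀ (s • Y) y)⁻¹ : (Matrix (Fin 2) (Fin 2) ℂ)ˣ) : Matrix (Fin 2) (Fin 2) ℂ))
        * ((frameTwS F n K h U₀ (s • Y) y : (Matrix (Fin 2) (Fin 2) ℂ)ˣ) : Matrix (Fin 2) (Fin 2) ℂ))
      ((ns (K - n) (siteShift (sites_eq F n K h) y)
            * fderiv ℂ (fun A : PBond (F.P K) 0 → Matrix (Fin 2) (Fin 2) ℂ => ((frameTwS F n K h U₀ A y : (Matrix (Fin 2) (Fin 2) ℂ)ˣ) : Matrix (Fin 2) (Fin 2) ℂ)) 0 Y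
          - fderiv ℂ (fun A : PBond (F.P K) 0 → Matrix (Fin 2) (Fin 2) ℂ => ((frameTwS F n K h U₀ A y : (Matrix (Fin 2) (Fin 2) ℂ)ˣ) : Matrix (Fin 2) (Fin 2) ℂ)) 0 Y
            * ns (K - n) (siteShift (sites_eq F n K h) y))
        + (N (embIter (K - n) (siteShift (sites_eq F n K h) y)) - ns (K - n) (siteShift (sites_eq F n K h) y))
            * fderiv ℂ (fun A : PBond (F.P K) 0 → Matrix (Fin 2) (Fin 2) ℂ => ((frameTwS F n K h U₀ A y : (Matrix (Fin 2) (Fin 2) ℂ)ˣ) : Matrix (Fin 2) (Fin 2) ℂ)) 0 Y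
        - (fderiv ℂ (fderiv ℂ (fun A : PBond (F.P K) 0 → Matrix (Fin 2) (Fin 2) ℂ => ((frameTwS F n K h U₀ A y : (Matrix (Fin 2) (Fin 2) ℂ)ˣ) : Matrix (Fin 2) (Fin 2) ℂ))) 0 Y
              (fun b : PBond (F.P K) 0 => N b.src - ((bgUnits F K U₀ b : (Matrix (Fin 2) (Fin 2) ℂ)ˣ) : Matrix (Fin 2) (Fin 2) ℂ) * N b.tgt * (((bgUnits F K U₀ b)⁻¹ : (Matrix (Fin 2) (Fin 2) ℂ)ˣ) : Matrix (Fin 2) (Fin 2) ℂ))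
            + fderiv ℂ (fun A : PBond (F.P K) 0 → Matrix (Fin 2) (Fin 2) ℂ => ((frameTwS F n K h U₀ A y : (Matrix (Fin 2) (Fin 2) ℂ)ˣ) : Matrix (Fin 2) (Fin 2) ℂ)) 0
              (fun b : PBond (F.P K) 0 => (2 : ℂ)⁻¹ •
                ((N b.src + ((bgUnits F K U₀ b : (Matrix (Fin 2) (Fin 2) ℂ)ˣ) : Matrix (Fin 2) (Fin 2) ℂ) * N b.tgt * (((bgUnits F K U₀ b)⁻¹ : (Matrix (Fin 2) (Fin 2) ℂ)ˣ) : Matrix (Fin 2) (Fin 2) ℂ)) * Y b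
                  - Y b * (N b.src + ((bgUnits F K U₀ b : (Matrix (Fin 2) (Fin 2) ℂ)ˣ) : Matrix (Fin 2) (Fin 2) ℂ) * N b.tgt * (((bgUnits F K U₀ b)⁻¹ : (Matrix (Fin 2) (Fin 2) ℂ)ˣ) : Matrix (Fin 2) (Fin 2) ℂ)))))) 0 := by
  -- abbreviations
  set w : (PBond (F.P K) 0 → Matrix (Fin 2) (Fin 2) ℂ) → Matrix (Fin 2) (Fin 2) ℂ :=
    fun A => ((frameTwS F n K h U₀ A y : (Matrix (Fin 2) (Fin 2) ℂ)ˣ) : Matrix (Fin 2) (Fin 2) ℂ) with hw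
  set gd : PBond (F.P K) 0 → Matrix (Fin 2) (Fin 2) ℂ :=
    fun b => N b.src - ((bgUnits F K U₀ b : (Matrix (Fin 2) (Fin 2) ℂ)ˣ) : Matrix (Fin 2) (Fin 2) ℂ) * N b.tgt * (((bgUnits F K U₀ b)⁻¹ : (Matrix (Fin 2) (Fin 2) ℂ)ˣ) : Matrix (Fin 2) (Fin 2) ℂ) with hgd
  set cm : PBond (F.P K) 0 → Matrix (Fin 2) (Fin 2) ℂ := fun b : PBond (F.P K) 0 => (2 : ℂ)⁻¹ •
    ((N b.src + ((bgUnits F K U₀ b : (Matrix (Fin 2) (Fin 2) ℂ)ˣ) : Matrix (Fin 2) (Fin 2) ℂ) * N b.tgt * (((bgUnits F K U₀ b)⁻¹ : (Matrix (Fin 2) (Fin 2) ℂ)ˣ) : Matrix (Fin 2) (Fin 2) ℂ)) * Y b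
      - Y b * (N b.src + ((bgUnits F K U₀ b : (Matrix (Fin 2) (Fin 2) ℂ)ˣ) : Matrix (Fin 2) (Fin 2) ℂ) * N b.tgt * (((bgUnits F K U₀ b)⁻¹ : (Matrix (Fin 2) (Fin 2) ℂ)ˣ) : Matrix (Fin 2) (Fin 2) ℂ))) with hcm
  set Nh : Matrix (Fin 2) (Fin 2) ℂ := N (embIter (K - n) (siteShift (sites_eq F n K h) y)) with hNh
  set nsy : Matrix (Fin 2) (Fin 2) ℂ := ns (K - n) (siteShift (sites_eq F n K h) y) with hnsy
  set v' : Matrix (Fin 2) (Fin 2) ℂ := fderiv ℂ w 0 Y with hv'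
  set vd' : Matrix (Fin 2) (Fin 2) ℂ := fderiv ℂ (fderiv ℂ w) 0 Y gd + fderiv ℂ w 0 cm with hvd'
  -- the three curves
  have hv : HasDerivAt (fun s : ℂ => ((frameTwS F n K h U₀ (s • Y) y : (Matrix (Fin 2) (Fin 2) ℂ)ˣ) : Matrix (Fin 2) (Fin 2) ℂ)) v' 0 :=
    hasDerivAt_frameTwS_smul F h hε₀ hWε U₀ hreg Y y
  have hv0 : frameTwS F n K h U₀ ((0 : ℂ) • Y) y = 1 := frameTwS_smul_zero F h U₀ Y y
  have hvinv : HasDerivAt (fun s : ℂ => (((frameTwS F n K h U₀ (s • Y) y)⁻¹ : (Matrix (Fin 2) (Fin 2) ℂ)ˣ) : Matrix (Fin 2) (Fin 2) ℂ)) (-v') 0 := by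
    have h1 := hasDerivAt_units_inv_complex (γ := fun s : ℂ => frameTwS F n K h U₀ (s • Y) y) hv
    rw [hv0, inv_one, Units.val_one, one_mul, mul_one] at h1
    exact h1
  have hvd := hasDerivAt_fderiv_frameTwS_smul_gaugeVelocity F h hε₀ hWε U₀ hreg Y N y
  have hvd0 : fderiv ℂ w ((0 : ℂ) • Y) (fun b : PBond (F.P K) 0 => fderiv ℂ (mlog : Matrix (Fin 2) (Fin 2) ℂ → Matrix (Fin 2) (Fin 2) ℂ) (exp (((0 : ℂ) • Y) b))
      (N b.src * exp (((0 : ℂ) • Y) b) - exp (((0 : ℂ) • Y) b)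
        * (((bgUnits F K U₀ b : (Matrix (Fin 2) (Fin 2) ℂ)ˣ) : Matrix (Fin 2) (Fin 2) ℂ) * N b.tgt * (((bgUnits F K U₀ b)⁻¹ : (Matrix (Fin 2) (Fin 2) ℂ)ˣ) : Matrix (Fin 2) (Fin 2) ℂ))))
      = Nh - nsy := by
    rw [zero_smul, gaugeVelocityAt_zero U₀ N, hw, fderiv_frameTwS_zero_gaugeDir F h hε₀ hWε U₀ hreg N ns h0 hsucc y]
  -- product rule: `s ↦ v⁻¹ · (Nh − vd · v⁻¹) · v`
  have hmid : HasDerivAt (fun s : ℂ => Nh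
      - fderiv ℂ w (s • Y) (fun b : PBond (F.P K) 0 => fderiv ℂ (mlog : Matrix (Fin 2) (Fin 2) ℂ → Matrix (Fin 2) (Fin 2) ℂ) (exp ((s • Y) b))
          (N b.src * exp ((s • Y) b) - exp ((s • Y) b)
            * (((bgUnits F K U₀ b : (Matrix (Fin 2) (Fin 2) ℂ)ˣ) : Matrix (Fin 2) (Fin 2) ℂ) * N b.tgt * (((bgUnits F K U₀ b)⁻¹ : (Matrix (Fin 2) (Fin 2) ℂ)ˣ) : Matrix (Fin 2) (Fin 2) ℂ))))
        * (((frameTwS F n K h U₀ (s • Y) y)⁻¹ : (Matrix (Fin 2) (Fin 2) ℂ)ˣ) : Matrix (Fin 2) (Fin 2) ℂ))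
      (-(vd' * 1 + (Nh - nsy) * (-v'))) 0 := by
    have h1 := (hvd.fun_mul hvinv).const_sub Nh
    rw [hvd0, hv0, inv_one, Units.val_one] at h1
    exact h1
  have hprod := (hvinv.fun_mul hmid).fun_mul hv
  refine hprod.congr_deriv ?_
  rw [hvd0, hv0, inv_one, Units.val_one]
  noncomm_ring

end Member

end Summit.QuantumFields.YangMills.Theorems.Prop7FrameResponseAtChartPoint

end
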